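import Literature.NumberTheory.LFunctions.HurwitzEulerMaclaurin
import Literature.NumberTheory.LFunctions.ZetaKernelEvaluation
import Mathlib.NumberTheory.LSeries.DirichletContinuation
import Literature.NumberTheory.LFunctions.PrimitiveQuadraticCharacterKronecker
import HarnessLib

/-!
# Certified multi-precision evaluation of the Hurwitz zeta function and of `L(s, χ₄)`

Topic `Literature/NumberTheory/LFunctions` (namespace `Literature.NumberTheory.LFunctions.HurwitzNumerics`).
The companion of `ZetaCertifiedEvaluation.lean` / `ZetaKernelEvaluation.lean` (certified boxes for
`ζ(s)`): an executable evaluator producing a complex box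
(`Literature.Analysis.ValidatedNumerics.NumericsMP.MC`) PROVED to contain the Hurwitz zeta function
`ζ(s, a) = HurwitzZeta.hurwitzZeta a s` for a rational parameter `a = p/q ∈ (0, 1]` and every `s` of a
given input box with `Re s > 0`, `s ≠ 1`, by the Euler–Maclaurin formula of arbitrary order for
`ζ(s, a)` (`Literature.NumberTheory.LFunctions.hurwitzZeta_eq_eulerMaclaurin_of_re_pos`,
`HurwitzEulerMaclaurin.lean`) evaluated in the multi-precision interval arithmetic of
`MultiPrecisionInterval.lean`, with the explicit remainder bound
`Literature.NumberTheory.LFunctions.norm_hurwitzEmRem_le_rat` (the same majorant as for `ζ`). Every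
ingredient reduces in the kernel (`decide +kernel`): logarithms by `ZetaNumerics.logNatK`
(`Nat.log2`), every power `(n+a)^{-s}` afresh (no factorisation).

From it, the certified evaluator of the Dirichlet `L`-function of the primitive character mod `4`,
`L(s, χ₄) = 4^{-s} (ζ(s, ¼) − ζ(s, ¾))` (Mathlib's `ZMod.LFunction` is by definition
`q^{-s} Σ_j χ(j) ζ(s, j/q)`; `LFunction_eq_hurwitz_of_isPrimitive_four`), consumed by the certificates
of the Conrey–Li `χ₄` negatives (`Literature/Barriers/RiemannHypothesis/DeBrangesPositivityDirichlet*.lean`).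

## Algorithm

With tables `logs[n] ∋ log (n + p/q) = log (nq+p) − log q` (`0 ≤ n ≤ N`), `logq ∋ log q`, `piI ∋ π`
at scale `S`:
* `(n+a)^{-s} = e^{-σ log(n+a)} · e^{-i t log(n+a)}` (`MI.exp`, `MC.expI`), each afresh (`cpowH`);
* main part `Σ_{n<N} (n+a)^{-s} + (N+a)·(N+a)^{-s}/(s-1) + ½(N+a)^{-s}`
  (`Literature.NumberTheory.LFunctions.hurwitzEmMainZero`), `N + a = (Nq+p)/q`;
* correction terms `T_1 = s (N+a)^{-s} q/(12 (Nq+p))`,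
  `T_{k+1} = T_k · r_k · (s+2k-1)(s+2k) · q²/(Nq+p)²` with the exact Bernoulli ratios `r_k` of
  `ZetaNumerics.emRatios`;
* remainder radius from `‖s(s+1)⋯(s+2ν)‖ ≤ Π (|σ+j| + |t|)` and `norm_hurwitzEmRem_le_rat`
  (`pochBoundH`, `remRadiusH` — copies of the `ζ` versions).

## Main definitions and results

Public interface (everything else — the tables `HTables`, their builder `mkHTables`, the box
primitives `cpowH`, `powTableH`, `mainBoxH`, `termsBoxH`, `remRadiusH`, `hurwitzBox`, `qpowBox`,
`lchi4Box` and their inclusion lemmas — is file-private plumbing):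

* **`hurwitzEval S N ν p q guard Klog Kpi Kexp kexp KI kI B`** — the certified evaluator of
  `ζ(s, p/q)` (`0 < p ≤ q`) on the box `B` at scale `S`, and **`mem_hurwitzEval`** —
  `s ∈ B → s ≠ 1 → hurwitzEval … B = some Z → ζ(s, p/q) ∈ Z` (`0 < lo (re B)` is tested).
* `isQuadratic_of_modulus_four`, `LFunction_eq_hurwitz_of_isPrimitive_four`
  (`L(s, χ) = 4^{-s}(ζ(s,¼) − ζ(s,¾))` for the primitive character mod `4`), **`lchi4Eval`**,
  **`mem_lchi4Eval`** — `s ∈ B → s ≠ 1 → lchi4Eval … B = some Z → L(s, χ) ∈ Z`.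

## References

* F. Johansson, *Rigorous high-precision computation of the Hurwitz zeta function and its
  derivatives*, Numer. Algorithms 69 (2015) 253–270, §2 (`ζ(s,a) = S + I + T + R`, Theorem 1: the
  rigorous remainder bound) — the algorithm formalised here, with the odd-order remainder and the
  majorant of `HurwitzEulerMaclaurin.lean` in place of Theorem 1's. [Johansson2014]
* H. M. Edwards, *Riemann's Zeta Function* (1974), §6.4 (Euler–Maclaurin). [Edwards1974]
* H. L. Montgomery, R. C. Vaughan, *Multiplicative Number Theory I*, CUP 2007, §10.1 and §4.3
  (Dirichlet `L`-functions via Hurwitz zeta functions; `χ₄`). [MontgomeryVaughan2007]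
* R. E. Moore, *Interval Analysis*, Prentice-Hall 1966 (inclusion property). [folklore]
-/

open Finset Complex
open Literature.Analysis.ValidatedNumerics.NumericsMP Literature.NumberTheory.LFunctions
open Literature.NumberTheory.LFunctions.ZetaNumerics (emRatios emCoeff emCoeffList emCoeffList_getD
  logNatK logNatK_eq)

namespace Literature.NumberTheory.LFunctions.HurwitzNumerics

/-! ## Tables -/

/-- The data of an evaluation of `ζ(s, p/q)`: scale `S`, truncation point `N`, order `ν`, the
parameter `a = p/q`, enclosures of `π`, `log q` and `log (n + p/q)` (`0 ≤ n ≤ N`) at scale `S`, the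
Euler–Maclaurin ratios, and the Taylor/argument-reduction parameters of `exp`, `expI`. [folklore] -/
private structure HTables where
  /-- scale -/
  S : ℕ
  /-- truncation point of the Euler–Maclaurin main sum -/
  N : ℕ
  /-- number of Bernoulli correction terms -/
  nu : ℕ
  /-- numerator of `a = p/q` -/
  p : ℕ
  /-- denominator of `a = p/q` -/
  q : ℕ
  /-- enclosure of `π` at scale `S` -/
  piI : MI
  /-- enclosure of `log q` at scale `S` -/
  logq : MI
  /-- `logs[n]` encloses `log (n + p/q)` for `0 ≤ n ≤ N` -/
  logs : Array MI
  /-- the ratios `r_1, …, r_{ν-1}` -/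
  ratios : List ℚ
  /-- Taylor terms for the real exponential -/
  Kexp : ℕ
  /-- halvings for the real exponential -/
  kexp : ℕ
  /-- Taylor terms for `expI` -/
  KI : ℕ
  /-- halvings for `expI` -/
  kI : ℕ

/-- The parameter `a = p/q` of the tables. [folklore] -/
private noncomputable def HTables.a (T : HTables) : ℝ := (T.p : ℝ) / T.q

/-- Validity of tables: positive scale, `N ≥ 1`, `ν ≥ 1`, `0 < p ≤ q`, correct enclosures, correct
ratios. [folklore] -/
private structure HTables.Valid (T : HTables) : Prop where
  S_pos : 0 < T.S
  one_le_N : 1 ≤ T.N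
  nu_ne : T.nu ≠ 0
  p_pos : 0 < T.p
  p_le_q : T.p ≤ T.q
  mem_pi : MI.mem T.S Real.pi T.piI
  mem_logq : MI.mem T.S (Real.log T.q) T.logq
  logs_size : T.logs.size = T.N + 1
  mem_logs : ∀ n : ℕ, n ≤ T.N → MI.mem T.S (Real.log (n + T.a)) (T.logs.getD n default)
  ratios_eq : emRatios T.nu = some T.ratios

/-- `0 < q` for valid tables. [folklore] -/
private lemma HTables.Valid.q_pos {T : HTables} (hT : T.Valid) : 0 < T.q := lt_of_lt_of_le hT.p_pos hT.p_le_q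

/-- `0 < a`. [folklore] -/
private lemma HTables.Valid.a_pos {T : HTables} (hT : T.Valid) : 0 < T.a := by
  unfold HTables.a
  exact div_pos (by exact_mod_cast hT.p_pos) (by exact_mod_cast hT.q_pos)

/-- `a ≤ 1`. [folklore] -/
private lemma HTables.Valid.a_le_one {T : HTables} (hT : T.Valid) : T.a ≤ 1 := by
  unfold HTables.a
  rw [div_le_one (by exact_mod_cast hT.q_pos)]
  exact_mod_cast hT.p_le_q

/-- Build the table `[log (0 + p/q), …, log (N + p/q)]` at scale `S` from `logNatK` evaluations of
`log (nq + p)` at the finer scale `S'` and an enclosure `Lq ∋ log q` at scale `S'` (`none` on failure).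
[folklore] -/
private def mkHLogs (S S' Klog p q : ℕ) (Lq : MI) : ℕ → Option (Array MI)
  | 0 =>
    match logNatK S' Klog p with
    | some L => some #[MI.rescale S' S (L.sub Lq)]
    | none => none
  | n + 1 =>
    match mkHLogs S S' Klog p q Lq n, logNatK S' Klog ((n + 1) * q + p) with
    | some A, some L => some (A.push (MI.rescale S' S (L.sub Lq)))
    | _, _ => none

/-- Build tables for `ζ(s, p/q)`: `π`, `log q` and the logarithms are computed at scale
`S · 2^guard` and rounded to `S`. [folklore] -/
private def mkHTables (S N nu p q guard Klog Kpi Kexp kexp KI kI : ℕ) : Option HTables :=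
  let S' := S * 2 ^ guard
  if 0 < S ∧ 1 ≤ N ∧ nu ≠ 0 ∧ 0 < p ∧ p ≤ q then
    match MI.pi S' Kpi, logNatK S' Klog q, emRatios nu with
    | some P, some Lq, some R =>
      match mkHLogs S S' Klog p q Lq N with
      | some A => some ⟨S, N, nu, p, q, MI.rescale S' S P, MI.rescale S' S Lq, A, R, Kexp, kexp, KI, kI⟩
      | none => none
    | _, _, _ => none
  else none

/-- `log (nq + p) − log q = log (n + p/q)` (`0 < p`, `0 < q`). [folklore] -/
private lemma log_sub_log_eq {p q : ℕ} (hp : 0 < p) (hq : 0 < q) (n : ℕ) :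
    Real.log ((n * q + p : ℕ) : ℝ) - Real.log q = Real.log (n + (p : ℝ) / q) := by
  have hq' : (0 : ℝ) < q := by exact_mod_cast hq
  have hm : (0 : ℝ) < ((n * q + p : ℕ) : ℝ) := by exact_mod_cast (by omega : 0 < n * q + p)
  rw [← Real.log_div hm.ne' hq'.ne']
  congr 1
  push_cast
  field_simp

/-- Soundness of `mkHLogs`: size `n + 1` and `log (m + p/q) ∈ logs[m]` for `m ≤ n`. [folklore] -/
private lemma mkHLogs_spec {S S' Klog p q : ℕ} (hS' : 0 < S') (hp : 0 < p) (hq : 0 < q) {Lq : MI}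
    (hLq : MI.mem S' (Real.log q) Lq) :
    ∀ (n : ℕ) {A : Array MI}, mkHLogs S S' Klog p q Lq n = some A →
      A.size = n + 1 ∧ ∀ m : ℕ, m ≤ n → MI.mem S (Real.log (m + (p : ℝ) / q)) (A.getD m default)
  | 0, A, h => by
    simp only [mkHLogs] at h
    split at h
    · rename_i L hL
      simp only [Option.some.injEq] at h
      subst h
      refine ⟨rfl, fun m hm ↦ ?_⟩
      obtain rfl : m = 0 := Nat.le_zero.1 hm
      rw [logNatK_eq] at hL
      have h1 := MI.mem_sub (MI.mem_logNat hS' hL) hLq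
      have h2 := MI.mem_rescale hS' S h1
      have e := log_sub_log_eq hp hq 0
      simp only [zero_mul, zero_add, Nat.cast_zero] at e
      rw [e] at h2
      simpa using h2
    · simp at h
  | n + 1, A, h => by
    simp only [mkHLogs] at h
    split at h
    · rename_i A0 L hA0 hL
      simp only [Option.some.injEq] at h
      subst h
      obtain ⟨hsz, hmem⟩ := mkHLogs_spec hS' hp hq hLq n hA0
      refine ⟨by simp [hsz], fun m hm ↦ ?_⟩
      rcases Nat.lt_succ_iff_lt_or_eq.1 (Nat.lt_succ_of_le hm) with hlt | heq
      · have hm' : m ≤ n := Nat.lt_succ_iff.1 hlt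
        have hlt' : m < A0.size := by rw [hsz]; omega
        have := hmem m hm'
        rw [Array.getD_eq_getD_getElem?, Array.getElem?_push_lt hlt', Option.getD_some]
        rw [Array.getD_eq_getD_getElem?, getElem?_pos A0 m hlt', Option.getD_some] at this
        exact this
      · subst heq
        have hidx : (A0.push (MI.rescale S' S (L.sub Lq)))[n + 1]? =
            some (MI.rescale S' S (L.sub Lq)) := by
          rw [← hsz]; exact Array.getElem?_push_size
        rw [Array.getD_eq_getD_getElem?, hidx, Option.getD_some]
        rw [logNatK_eq] at hL
        have h1 := MI.mem_sub (MI.mem_logNat hS' hL) hLq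
        have h2 := MI.mem_rescale hS' S h1
        rw [log_sub_log_eq hp hq (n + 1)] at h2
        push_cast at h2 ⊢
        exact h2
    · simp at h

/-- Tables built by `mkHTables` are valid. [folklore] -/
private theorem mkHTables_valid {S N nu p q guard Klog Kpi Kexp kexp KI kI : ℕ} {T : HTables}
    (h : mkHTables S N nu p q guard Klog Kpi Kexp kexp KI kI = some T) : T.Valid := by
  unfold mkHTables at h
  simp only at h
  split_ifs at h with hc
  split at h
  · rename_i P Lq R hP hLq hR
    split at h
    · rename_i A hA
      simp only [Option.some.injEq] at h
      subst h
      obtain ⟨hS, hN, hnu, hp, hpq⟩ := hc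
      have hq : 0 < q := lt_of_lt_of_le hp hpq
      have hS' : 0 < S * 2 ^ guard := Nat.mul_pos hS (pow_pos (by norm_num) _)
      rw [logNatK_eq] at hLq
      have hLq' := MI.mem_logNat hS' hLq
      obtain ⟨hsz, hmem⟩ := mkHLogs_spec (S := S) (Klog := Klog) hS' hp hq hLq' N hA
      exact ⟨hS, hN, hnu, hp, hpq, MI.mem_rescale hS' S (MI.mem_pi _ hP),
        MI.mem_rescale hS' S hLq', hsz, fun n hn ↦ hmem n hn, hR⟩
    · simp at h
  · simp at h

/-- `mkHTables` records the scale it is given. [folklore] -/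
private theorem mkHTables_S {S N nu p q guard Klog Kpi Kexp kexp KI kI : ℕ} {T : HTables}
    (h : mkHTables S N nu p q guard Klog Kpi Kexp kexp KI kI = some T) : T.S = S := by
  unfold mkHTables at h
  simp only at h
  split_ifs at h
  split at h
  · split at h
    · simp only [Option.some.injEq] at h
      subst h; rfl
    · simp at h
  · simp at h

/-- `mkHTables` records the parameter `p` it is given. [folklore] -/
private theorem mkHTables_p {S N nu p q guard Klog Kpi Kexp kexp KI kI : ℕ} {T : HTables}
    (h : mkHTables S N nu p q guard Klog Kpi Kexp kexp KI kI = some T) : T.p = p := by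
  unfold mkHTables at h
  simp only at h
  split_ifs at h
  split at h
  · split at h
    · simp only [Option.some.injEq] at h
      subst h; rfl
    · simp at h
  · simp at h

/-- `mkHTables` records the parameter `q` it is given. [folklore] -/
private theorem mkHTables_q {S N nu p q guard Klog Kpi Kexp kexp KI kI : ℕ} {T : HTables}
    (h : mkHTables S N nu p q guard Klog Kpi Kexp kexp KI kI = some T) : T.q = q := by
  unfold mkHTables at h
  simp only at h
  split_ifs at h
  split at h
  · split at h
    · simp only [Option.some.injEq] at h
      subst h; rfl
    · simp at h
  · simp at h

/-! ## Powers `(n+a)^{-s}` and `q^{-s}` -/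

/-- `(n+a)^{-s} = e^{-σ log(n+a)} · e^{-i t log(n+a)}` evaluated afresh from the tables. [folklore] -/
private def cpowH (T : HTables) (sB : MC) (n : ℕ) : Option MC :=
  let L := T.logs.getD n default
  match MI.exp T.S T.Kexp T.kexp ((sB.re.mul T.S L).neg),
    MC.expI T.S T.KI T.kI T.piI ((sB.im.mul T.S L).neg) with
  | some mag, some ph => some (ph.mulMI T.S mag)
  | _, _ => none

/-- `q^{-s} = e^{-σ log q} · e^{-i t log q}` from the tables. [folklore] -/
private def qpowBox (T : HTables) (sB : MC) : Option MC :=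
  match MI.exp T.S T.Kexp T.kexp ((sB.re.mul T.S T.logq).neg),
    MC.expI T.S T.KI T.kI T.piI ((sB.im.mul T.S T.logq).neg) with
  | some mag, some ph => some (ph.mulMI T.S mag)
  | _, _ => none

/-- The table `[(0+a)^{-s}, (1+a)^{-s}, …, (m-1+a)^{-s}]` of enclosures (size `m`), each entry
afresh. [folklore] -/
private def powTableH (T : HTables) (sB : MC) : ℕ → Option (Array MC)
  | 0 => some #[]
  | m + 1 =>
    match powTableH T sB m with
    | none => none
    | some A =>
      match cpowH T sB m with
      | none => none
      | some b => some (A.push b)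

/-! ## The evaluator -/

/-- Sum of the table entries `(0+a)^{-s} + ⋯ + (n-1+a)^{-s}`. [folklore] -/
private def sumPowH (A : Array MC) : ℕ → MC → MC
  | 0, acc => acc
  | n + 1, acc => sumPowH A n (acc.add (A.getD n default))

/-- The Euler–Maclaurin main part `Σ_{n<N} (n+a)^{-s} + (N+a)·(N+a)^{-s}/(s-1) + ½ (N+a)^{-s}`,
`N + a = (Nq+p)/q`. [folklore] -/
private def mainBoxH (T : HTables) (sB : MC) (A : Array MC) : Option MC :=
  let PN := A.getD T.N default
  match MC.divBox T.S ((PN.mulInt ((T.N * T.q + T.p : ℕ) : ℤ)).divNat T.q)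
    (sB.sub (MC.ofInt T.S 1)) with
  | some r => some (((sumPowH A T.N (MC.ofInt T.S 0)).add r).add (PN.divNat 2))
  | none => none

/-- Accumulate the correction terms: from `T_k ∈ tk` and the ratios `r_k, r_{k+1}, …` produce
`Σ_{j=k}^{ν} T_j` added to `acc`; `T_{k+1} = T_k · r_k · (s+2k-1)(s+2k) · q²/(Nq+p)²`. [folklore] -/
private def termsAuxH (T : HTables) (sB : MC) : List ℚ → ℕ → MC → MC → MC
  | [], _, tk, acc => acc.add tk
  | r :: rs, k, tk, acc =>
      let f := MC.mul T.S (sB.add (MC.ofInt T.S (2 * k - 1))) (sB.add (MC.ofInt T.S (2 * k)))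
      let tk' := ((MC.mul T.S (tk.mulMI T.S (MI.ofFrac T.S r.num r.den)) f).mulInt
        ((T.q * T.q : ℕ) : ℤ)).divNat ((T.N * T.q + T.p) * (T.N * T.q + T.p))
      termsAuxH T sB rs (k + 1) tk' (acc.add tk)

/-- The sum of the correction terms `Σ_{k=1}^{ν} T_k`, `T_1 = s (N+a)^{-s} q / (12 (Nq+p))`.
[folklore] -/
private def termsBoxH (T : HTables) (sB : MC) (A : Array MC) : MC :=
  let PN := A.getD T.N default
  let t1 := ((MC.mul T.S sB PN).mulInt (T.q : ℤ)).divNat (12 * (T.N * T.q + T.p))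
  termsAuxH T sB T.ratios 1 t1 (MC.ofInt T.S 0)

/-- Upper bound, at scale `S`, for `Π_{j<m} (|σ + j| + |t|)` over the box. [folklore] -/
private def pochBoundH (T : HTables) (sB : MC) : ℕ → ℤ
  | 0 => T.S
  | j + 1 => Literature.Analysis.ValidatedNumerics.Numerics.cdiv
      (pochBoundH T sB j * ((sB.re.add (MI.ofInt T.S j)).absHi + sB.im.absHi)) T.S

/-- The remainder radius (scaled by `S`):
`⌈U · 33 · 25^{2ν+1} / (10 · 157^{2ν+1} · N^{2ν} · 2ν)⌉`, `U = pochBoundH (2ν+1)`. [folklore] -/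
private def remRadiusH (T : HTables) (sB : MC) : ℤ :=
  Literature.Analysis.ValidatedNumerics.Numerics.cdiv
    (pochBoundH T sB (2 * T.nu + 1) * 33 * 25 ^ (2 * T.nu + 1))
    (10 * 157 ^ (2 * T.nu + 1) * (T.N : ℤ) ^ (2 * T.nu) * (2 * T.nu))

/-- **The certified evaluator of `ζ(s, p/q)`**: a box containing `ζ(s, a)` for all `s` in `sB`
(requires `0 < lo (re sB)`; soundness `mem_hurwitzBox` additionally needs `s ≠ 1`). [folklore] -/
private def hurwitzBox (T : HTables) (sB : MC) : Option MC :=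
  if 0 < sB.re.lo then
    match powTableH T sB (T.N + 1) with
    | none => none
    | some A =>
      match mainBoxH T sB A with
      | none => none
      | some M => some ((M.add (termsBoxH T sB A)).widen (remRadiusH T sB))
  else none

/-! ## Soundness -/

section Soundness

/-- `x^{-s} = e^{-i t log x} · e^{-σ log x}` for real `x > 0`. [folklore] -/
private lemma ofReal_cpow_neg_eq {x : ℝ} (hx : 0 < x) (s : ℂ) :
    ((x : ℝ) : ℂ) ^ (-s) = Complex.exp (((-(s.im * Real.log x) : ℝ) : ℂ) * I) *
      ((Real.exp (-(s.re * Real.log x)) : ℝ) : ℂ) := by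
  have hx0 : ((x : ℝ) : ℂ) ≠ 0 := ofReal_ne_zero.2 hx.ne'
  rw [cpow_def_of_ne_zero hx0, ← ofReal_log hx.le, Complex.ofReal_exp, ← Complex.exp_add]
  congr 1
  apply Complex.ext <;> simp <;> ring

variable {T : HTables} {s : ℂ} {sB : MC}

/-- Soundness of `cpowH`: `(n+a)^{-s} ∈ cpowH T sB n` for `n ≤ N`. [folklore] -/
private theorem mem_cpowH (hT : T.Valid) (hs : MC.mem T.S s sB) {n : ℕ} (hnN : n ≤ T.N) {B : MC}
    (h : cpowH T sB n = some B) : MC.mem T.S ((((n + T.a : ℝ)) : ℂ) ^ (-s)) B := by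
  unfold cpowH at h
  simp only at h
  split at h
  · rename_i mag ph hmag hph
    simp only [Option.some.injEq] at h
    subst h
    have hL := hT.mem_logs n hnN
    have h1 : MI.mem T.S (-(s.re * Real.log (n + T.a))) ((sB.re.mul T.S (T.logs.getD n default)).neg) :=
      MI.mem_neg (MI.mem_mul hT.S_pos hs.1 hL)
    have h2 : MI.mem T.S (-(s.im * Real.log (n + T.a))) ((sB.im.mul T.S (T.logs.getD n default)).neg) :=
      MI.mem_neg (MI.mem_mul hT.S_pos hs.2 hL)
    have hm := MI.mem_exp hT.S_pos hmag h1
    have hp := MC.mem_expI hT.S_pos hT.mem_pi hph h2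
    have hna : 0 < (n : ℝ) + T.a := by have := hT.a_pos; positivity
    rw [ofReal_cpow_neg_eq hna]
    exact MC.mem_mulMI hT.S_pos hp hm
  · simp at h

/-- Soundness of `qpowBox`: `q^{-s} ∈ qpowBox T sB`. [folklore] -/
private theorem mem_qpowBox (hT : T.Valid) (hs : MC.mem T.S s sB) {B : MC} (h : qpowBox T sB = some B) :
    MC.mem T.S ((T.q : ℂ) ^ (-s)) B := by
  unfold qpowBox at h
  split at h
  · rename_i mag ph hmag hph
    simp only [Option.some.injEq] at h
    subst h
    have hL := hT.mem_logq
    have h1 : MI.mem T.S (-(s.re * Real.log T.q)) ((sB.re.mul T.S T.logq).neg) :=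
      MI.mem_neg (MI.mem_mul hT.S_pos hs.1 hL)
    have h2 : MI.mem T.S (-(s.im * Real.log T.q)) ((sB.im.mul T.S T.logq).neg) :=
      MI.mem_neg (MI.mem_mul hT.S_pos hs.2 hL)
    have hm := MI.mem_exp hT.S_pos hmag h1
    have hp := MC.mem_expI hT.S_pos hT.mem_pi hph h2
    have hq : (0 : ℝ) < T.q := by exact_mod_cast hT.q_pos
    rw [show (T.q : ℂ) = ((T.q : ℝ) : ℂ) from (Complex.ofReal_natCast T.q).symm,
      ofReal_cpow_neg_eq hq s]
    exact MC.mem_mulMI hT.S_pos hp hm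
  · simp at h

/-- Soundness of the power table: size `m` and `(n+a)^{-s} ∈ A[n]` for `n < m`. [folklore] -/
private theorem powTableH_spec (hT : T.Valid) (hs : MC.mem T.S s sB) :
    ∀ (m : ℕ) {A : Array MC}, m ≤ T.N + 1 → powTableH T sB m = some A →
      A.size = m ∧ ∀ n : ℕ, n < m → MC.mem T.S ((((n + T.a : ℝ)) : ℂ) ^ (-s)) (A.getD n default)
  | 0, A, _, h => by
    simp only [powTableH, Option.some.injEq] at h
    subst h
    exact ⟨rfl, fun n hn ↦ absurd hn (Nat.not_lt_zero n)⟩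
  | m + 1, A, hm, h => by
    simp only [powTableH] at h
    split at h
    · simp at h
    · rename_i A0 hA0
      split at h
      · simp at h
      · rename_i b hb
        simp only [Option.some.injEq] at h
        subst h
        obtain ⟨hsz, hmem⟩ := powTableH_spec hT hs m (by omega) hA0
        refine ⟨by simp [hsz], fun n hn ↦ ?_⟩
        rcases Nat.lt_succ_iff_lt_or_eq.1 hn with hlt | heq
        · have hlt' : n < A0.size := by rw [hsz]; exact hlt
          have := hmem n hlt
          rw [Array.getD_eq_getD_getElem?, Array.getElem?_push_lt hlt', Option.getD_some]
          rw [Array.getD_eq_getD_getElem?, getElem?_pos A0 n hlt', Option.getD_some] at this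
          exact this
        · subst heq
          have hidx : (A0.push b)[n]? = some b := by
            rw [← hsz]; exact Array.getElem?_push_size
          rw [Array.getD_eq_getD_getElem?, hidx, Option.getD_some]
          exact mem_cpowH hT hs (by omega) hb

/-- Soundness of `sumPowH`. [folklore] -/
private lemma sumPowH_spec (hT : T.Valid) {A : Array MC} {M : ℕ}
    (hA : ∀ n : ℕ, n ≤ M → MC.mem T.S ((((n + T.a : ℝ)) : ℂ) ^ (-s)) (A.getD n default)) :
    ∀ (n : ℕ) {acc : MC} {z : ℂ}, n ≤ M + 1 → MC.mem T.S z acc →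
      MC.mem T.S (z + ∑ j ∈ Finset.range n, (((j + T.a : ℝ)) : ℂ) ^ (-s)) (sumPowH A n acc)
  | 0, acc, z, _, h => by simpa [sumPowH] using h
  | n + 1, acc, z, hn, h => by
    simp only [sumPowH]
    have h' := MC.mem_add h (hA n (by omega))
    have := sumPowH_spec hT hA n (by omega) h'
    convert this using 1
    rw [Finset.sum_range_succ]
    ring

/-- Soundness of `mainBoxH`. [folklore] -/
private theorem mem_mainBoxH (hT : T.Valid) (hs : MC.mem T.S s sB) {A : Array MC}
    (hA : ∀ n : ℕ, n ≤ T.N → MC.mem T.S ((((n + T.a : ℝ)) : ℂ) ^ (-s)) (A.getD n default))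
    {M : MC} (h : mainBoxH T sB A = some M) : MC.mem T.S (hurwitzEmMainZero T.N T.a s) M := by
  unfold mainBoxH at h
  simp only at h
  split at h
  · rename_i r hr
    simp only [Option.some.injEq] at h
    subst h
    have hPN := hA T.N le_rfl
    have hsum := sumPowH_spec hT (M := T.N) hA T.N (by omega) (MC.mem_ofInt T.S 0)
    simp only [Int.cast_zero, zero_add] at hsum
    have hq0 : (0 : ℝ) < T.q := by exact_mod_cast hT.q_pos
    have hNa : (((T.N + T.a : ℝ)) : ℂ) ≠ 0 := ofReal_ne_zero.2 (by have := hT.a_pos; positivity)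
    have hNa' : ((T.N : ℝ) + T.a) = ((T.N * T.q + T.p : ℕ) : ℝ) / T.q := by
      unfold HTables.a
      push_cast
      field_simp
    have hr' : MC.mem T.S ((((T.N + T.a : ℝ)) : ℂ) ^ (1 - s) / (s - 1)) r := by
      have h0 := MC.mem_divNat (MC.mem_mulInt hPN ((T.N * T.q + T.p : ℕ) : ℤ)) hT.q_pos
      have h1 := MC.mem_divBox hT.S_pos hr h0 (MC.mem_sub hs (MC.mem_ofInt T.S 1))
      convert h1 using 1
      rw [sub_eq_add_neg, cpow_add _ _ hNa, cpow_one, hNa']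
      push_cast
      ring
    have hhalf : MC.mem T.S ((((T.N + T.a : ℝ)) : ℂ) ^ (-s) / 2) ((A.getD T.N default).divNat 2) := by
      have := MC.mem_divNat hPN (n := 2) (by norm_num)
      simpa using this
    unfold hurwitzEmMainZero
    simpa [add_assoc] using MC.mem_add (MC.mem_add hsum hr') hhalf
  · simp at h

/-- The recursion of the correction terms:
`T_{k+1} = T_k · (c_{k+1}/c_k) · (s+2k-1)(s+2k)/(N+a)²` written multiplicatively. [folklore] -/
private lemma hurwitzEmTerm_succ (hT : T.Valid) (k : ℕ) (hk : 1 ≤ k) (r : ℚ)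
    (hr : emCoeff (k + 1) = emCoeff k * r) :
    hurwitzEmTerm T.N T.a s (k + 1) =
      hurwitzEmTerm T.N T.a s k * (r : ℂ) * ((s + ((2 * k - 1 : ℕ) : ℂ)) * (s + ((2 * k : ℕ) : ℂ))) /
        (((T.N + T.a : ℝ)) : ℂ) / (((T.N + T.a : ℝ)) : ℂ) := by
  have hc : ∀ j, ((bernoulli (2 * j) : ℚ) : ℂ) / (2 * j).factorial = ((emCoeff j : ℚ) : ℂ) := by
    intro j
    rw [emCoeff]
    push_cast
    rfl
  unfold hurwitzEmTerm
  rw [hc, hc, hr]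
  have e1 : 2 * (k + 1) - 1 = 2 * k - 1 + 1 + 1 := by omega
  rw [e1, emPoch_succ, emPoch_succ]
  have hX0 : (((T.N + T.a : ℝ)) : ℂ) ≠ 0 := ofReal_ne_zero.2 (by have := hT.a_pos; positivity)
  have hX : (((T.N + T.a : ℝ)) : ℂ) ^ (-(s + ((2 * k - 1 + 1 + 1 : ℕ) : ℂ))) =
      (((T.N + T.a : ℝ)) : ℂ) ^ (-(s + ((2 * k - 1 : ℕ) : ℂ))) / (((T.N + T.a : ℝ)) : ℂ) /
        (((T.N + T.a : ℝ)) : ℂ) := by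
    rw [div_div, ← pow_two, ← cpow_natCast, ← cpow_sub _ _ hX0]
    congr 1
    push_cast
    ring
  rw [hX]
  have e2 : ((2 * k - 1 + 1 : ℕ) : ℂ) = ((2 * k : ℕ) : ℂ) := by
    norm_cast; omega
  push_cast [e2]
  ring

/-- The ratios recorded in valid tables satisfy `c_{k+1} = c_k · r_k`. [folklore] -/
private lemma ratios_spec (hT : T.Valid) : T.ratios.length = T.nu - 1 + 0 ∧
    ∀ i : ℕ, i + 1 < T.nu + 0 → emCoeff (i + 2) = emCoeff (i + 1) * T.ratios.getD i 0 := by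
  have h := hT.ratios_eq
  unfold ZetaNumerics.emRatios at h
  simp only at h
  split_ifs at h with hall
  simp only [Option.some.injEq] at h
  have hcs : ∀ j, j < T.nu + 2 → (emCoeffList T.nu).getD j 0 = emCoeff j := fun j hj ↦
    emCoeffList_getD hj
  constructor
  · rw [← h]; simp
  · intro i hi
    rw [List.all_eq_true] at hall
    have hne := hall i (List.mem_range.2 (by omega))
    simp only [decide_eq_true_eq] at hne
    rw [hcs (i + 1) (by omega)] at hne
    rw [← h, List.getD_eq_getElem?_getD, List.getElem?_map, List.getElem?_range (by omega)]
    simp only [Option.map_some, Option.getD_some]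
    rw [hcs (i + 2) (by omega), hcs (i + 1) (by omega)]
    field_simp

/-- Soundness of `termsAuxH`. [folklore] -/
private lemma termsAuxH_spec (hT : T.Valid) (hs : MC.mem T.S s sB) :
    ∀ (rs : List ℚ) (k : ℕ) {tk acc : MC} {z : ℂ}, 1 ≤ k → k + rs.length = T.nu →
      (∀ i : ℕ, i < rs.length → emCoeff (k + i + 1) = emCoeff (k + i) * rs.getD i 0) →
      MC.mem T.S (hurwitzEmTerm T.N T.a s k) tk → MC.mem T.S z acc →
      MC.mem T.S (z + ∑ j ∈ Finset.Icc k T.nu, hurwitzEmTerm T.N T.a s j)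
        (termsAuxH T sB rs k tk acc)
  | [], k, tk, acc, z, hk, hlen, _, htk, hacc => by
    simp only [List.length_nil, add_zero] at hlen
    simp only [termsAuxH, ← hlen, Finset.Icc_self, Finset.sum_singleton]
    exact MC.mem_add hacc htk
  | r :: rs, k, tk, acc, z, hk, hlen, hrs, htk, hacc => by
    simp only [termsAuxH]
    have hr : emCoeff (k + 1) = emCoeff k * r := by
      have := hrs 0 (by simp)
      simpa using this
    have hm0 : 0 < (T.N * T.q + T.p) * (T.N * T.q + T.p) := by
      have := hT.p_pos; positivity
    have htk' : MC.mem T.S (hurwitzEmTerm T.N T.a s (k + 1))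
        (((MC.mul T.S (tk.mulMI T.S (MI.ofFrac T.S r.num r.den))
          (MC.mul T.S (sB.add (MC.ofInt T.S (2 * k - 1))) (sB.add (MC.ofInt T.S (2 * k))))).mulInt
            ((T.q * T.q : ℕ) : ℤ)).divNat ((T.N * T.q + T.p) * (T.N * T.q + T.p))) := by
      rw [hurwitzEmTerm_succ hT k hk r hr]
      have hrm : MI.mem T.S ((r : ℝ)) (MI.ofFrac T.S r.num r.den) := by
        have := MI.mem_ofFrac T.S r.num (q := r.den) r.den_pos
        convert this using 1
        exact_mod_cast (Rat.num_div_den r).symm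
      have h1 : MC.mem T.S (hurwitzEmTerm T.N T.a s k * (r : ℂ))
          (tk.mulMI T.S (MI.ofFrac T.S r.num r.den)) := by
        have := MC.mem_mulMI hT.S_pos htk hrm
        simpa only [Complex.ofReal_ratCast] using this
      have h2 : MC.mem T.S ((s + ((2 * k - 1 : ℕ) : ℂ)) * (s + ((2 * k : ℕ) : ℂ)))
          (MC.mul T.S (sB.add (MC.ofInt T.S (2 * k - 1))) (sB.add (MC.ofInt T.S (2 * k)))) := by
        have ha := MC.mem_add hs (MC.mem_ofInt T.S (2 * (k : ℤ) - 1))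
        have hb := MC.mem_add hs (MC.mem_ofInt T.S (2 * (k : ℤ)))
        have := MC.mem_mul hT.S_pos ha hb
        have e : (((2 * (k : ℤ) - 1 : ℤ)) : ℂ) = ((2 * k - 1 : ℕ) : ℂ) := by
          rw [Nat.cast_sub (by omega)]; push_cast; ring
        have e' : (((2 * (k : ℤ) : ℤ)) : ℂ) = ((2 * k : ℕ) : ℂ) := by push_cast; ring
        rw [e, e'] at this
        exact this
      have h3 := MC.mem_mul hT.S_pos h1 h2
      have h4 := MC.mem_divNat (MC.mem_mulInt h3 ((T.q * T.q : ℕ) : ℤ)) hm0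
      convert h4 using 1
      have hq0 : (T.q : ℂ) ≠ 0 := by exact_mod_cast hT.q_pos.ne'
      have hm : ((T.N * T.q + T.p : ℕ) : ℂ) ≠ 0 := by
        have := hT.p_pos; exact_mod_cast (by positivity : (T.N * T.q + T.p) ≠ 0)
      have hNa : (((T.N + T.a : ℝ)) : ℂ) = ((T.N * T.q + T.p : ℕ) : ℂ) / T.q := by
        unfold HTables.a
        push_cast
        field_simp
      rw [hNa]
      push_cast
      field_simp
    have := termsAuxH_spec hT hs rs (k + 1) (by omega) (by simp at hlen ⊢; omega)
      (fun i hi ↦ by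
        have := hrs (i + 1) (by simp; omega)
        simp only [List.getD_cons_succ] at this
        rw [show k + 1 + i + 1 = k + (i + 1) + 1 by ring, show k + 1 + i = k + (i + 1) by ring]
        exact this)
      htk' (MC.mem_add hacc htk)
    have hkle : k ≤ T.nu := by simp at hlen; omega
    have hsplit : ∑ j ∈ Finset.Icc k T.nu, hurwitzEmTerm T.N T.a s j =
        hurwitzEmTerm T.N T.a s k + ∑ j ∈ Finset.Icc (k + 1) T.nu, hurwitzEmTerm T.N T.a s j := by
      have : Finset.Icc k T.nu = insert k (Finset.Icc (k + 1) T.nu) := by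
        ext j; simp; omega
      rw [this, Finset.sum_insert (by simp)]
    rw [hsplit, ← add_assoc]
    exact this

/-- Soundness of `termsBoxH`. [folklore] -/
private theorem mem_termsBoxH (hT : T.Valid) (hs : MC.mem T.S s sB) {A : Array MC}
    (hA : ∀ n : ℕ, n ≤ T.N → MC.mem T.S ((((n + T.a : ℝ)) : ℂ) ^ (-s)) (A.getD n default)) :
    MC.mem T.S (∑ j ∈ Finset.Icc 1 T.nu, hurwitzEmTerm T.N T.a s j) (termsBoxH T sB A) := by
  have hPN := hA T.N le_rfl
  obtain ⟨hlen, hrat⟩ := ratios_spec hT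
  have hm0 : 0 < 12 * (T.N * T.q + T.p) := by have := hT.p_pos; positivity
  have ht1 : MC.mem T.S (hurwitzEmTerm T.N T.a s 1)
      (((MC.mul T.S sB (A.getD T.N default)).mulInt (T.q : ℤ)).divNat (12 * (T.N * T.q + T.p))) := by
    have := MC.mem_divNat (MC.mem_mulInt (MC.mem_mul hT.S_pos hs hPN) (T.q : ℤ)) hm0
    convert this using 1
    unfold hurwitzEmTerm
    have hb2 : (bernoulli (2 * 1) : ℚ) = 1 / 6 := by
      rw [show 2 * 1 = 2 by rfl, bernoulli_eq_bernoulli'_of_ne_one (by norm_num), bernoulli'_two]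
    rw [hb2]
    have hX0 : (((T.N + T.a : ℝ)) : ℂ) ≠ 0 := ofReal_ne_zero.2 (by have := hT.a_pos; positivity)
    have hq0 : (T.q : ℂ) ≠ 0 := by exact_mod_cast hT.q_pos.ne'
    have hm : ((T.N * T.q + T.p : ℕ) : ℂ) ≠ 0 := by
      have := hT.p_pos; exact_mod_cast (by positivity : (T.N * T.q + T.p) ≠ 0)
    simp only [show 2 * 1 - 1 = 1 by rfl, emPoch_one, show (2 * 1).factorial = 2 by rfl]
    rw [show -(s + ((1 : ℕ) : ℂ)) = -s - 1 by push_cast; ring, cpow_sub _ _ hX0, cpow_one]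
    have hNa : (((T.N + T.a : ℝ)) : ℂ) = ((T.N * T.q + T.p : ℕ) : ℂ) / T.q := by
      unfold HTables.a
      push_cast
      field_simp
    rw [hNa]
    push_cast
    field_simp
    ring
  have := termsAuxH_spec hT hs T.ratios 1 (by norm_num) (by rw [hlen]; have := hT.nu_ne; omega)
    (fun i hi ↦ by
      have := hrat i (by rw [hlen] at hi; omega)
      rw [show 1 + i + 1 = i + 2 by ring, show 1 + i = i + 1 by ring]
      exact this)
    ht1 (MC.mem_ofInt T.S 0)
  simpa [termsBoxH] using this

/-- Soundness of `pochBoundH`: `Π_{j<m} (|σ+j|+|t|) · S ≤ pochBoundH m`. [folklore] -/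
private lemma pochBoundH_spec (hT : T.Valid) (hs : MC.mem T.S s sB) :
    ∀ m : ℕ, (∏ j ∈ range m, (|s.re + j| + |s.im|)) * T.S ≤ (pochBoundH T sB m : ℝ)
  | 0 => by simp [pochBoundH]
  | m + 1 => by
    have ih := pochBoundH_spec hT hs m
    have hSr : (0 : ℝ) < T.S := by exact_mod_cast hT.S_pos
    have hSz : (0 : ℤ) < T.S := by exact_mod_cast hT.S_pos
    simp only [pochBoundH]
    have ha : (|s.re + m| + |s.im|) * T.S ≤
        (((sB.re.add (MI.ofInt T.S m)).absHi + sB.im.absHi : ℤ) : ℝ) := by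
      have h1 := MI.abs_le_absHi (MI.mem_add hs.1 (MI.mem_ofInt T.S (m : ℤ)))
      have h2 := MI.abs_le_absHi hs.2
      push_cast at h1 ⊢
      nlinarith
    have hP : 0 ≤ ∏ j ∈ range m, (|s.re + j| + |s.im|) :=
      prod_nonneg fun _ _ ↦ by positivity
    have key : (∏ j ∈ range (m + 1), (|s.re + j| + |s.im|)) * T.S * T.S ≤
        (pochBoundH T sB m : ℝ) * (((sB.re.add (MI.ofInt T.S m)).absHi + sB.im.absHi : ℤ) : ℝ) := by
      rw [prod_range_succ]
      calc (∏ j ∈ range m, (|s.re + j| + |s.im|)) * (|s.re + m| + |s.im|) * T.S * T.S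
          = ((∏ j ∈ range m, (|s.re + j| + |s.im|)) * T.S) * ((|s.re + m| + |s.im|) * T.S) := by
            ring
        _ ≤ (pochBoundH T sB m : ℝ) *
            (((sB.re.add (MI.ofInt T.S m)).absHi + sB.im.absHi : ℤ) : ℝ) :=
            mul_le_mul ih ha (by positivity) (le_trans (by positivity) ih)
    have hc := Literature.Analysis.ValidatedNumerics.Numerics.le_cdiv_mul_real
      (a := pochBoundH T sB m * ((sB.re.add (MI.ofInt T.S m)).absHi + sB.im.absHi)) hSz
    push_cast at hc key ⊢
    exact le_of_mul_le_mul_right (key.trans hc) hSr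

/-- Soundness of the remainder radius: `‖R_ν(s, a)‖ · S ≤ remRadiusH`. [folklore] -/
private theorem norm_hurwitzEmRem_mul_le_remRadiusH (hT : T.Valid) (hs : MC.mem T.S s sB) (hσ : 0 < s.re) :
    ‖hurwitzEmRem T.N T.nu T.a s‖ * T.S ≤ (remRadiusH T sB : ℝ) := by
  have hN1 : 1 ≤ T.N := hT.one_le_N
  have hSr : (0 : ℝ) < T.S := by exact_mod_cast hT.S_pos
  have hR := norm_hurwitzEmRem_le_rat hN1 hT.a_pos hσ hT.nu_ne
  have hP := (norm_emPoch_le s (2 * T.nu + 1)).trans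
    ((le_div_iff₀ hSr).2 (pochBoundH_spec hT hs (2 * T.nu + 1)))
  have hν0 : (0 : ℝ) < T.nu := by exact_mod_cast Nat.pos_of_ne_zero hT.nu_ne
  have hN0 : (0 : ℝ) < T.N := by exact_mod_cast hN1
  set U : ℤ := pochBoundH T sB (2 * T.nu + 1) with hU
  have hden : (0 : ℤ) < 10 * 157 ^ (2 * T.nu + 1) * (T.N : ℤ) ^ (2 * T.nu) * (2 * T.nu) := by
    have : (0 : ℤ) < T.N := by exact_mod_cast hN1
    have : (0 : ℤ) < T.nu := by exact_mod_cast Nat.pos_of_ne_zero hT.nu_ne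
    positivity
  have hc := Literature.Analysis.ValidatedNumerics.Numerics.div_le_cdiv
    (a := U * 33 * 25 ^ (2 * T.nu + 1)) hden
  unfold remRadiusH
  refine le_trans ?_ hc
  push_cast
  rw [le_div_iff₀ (by exact_mod_cast hden)]
  have hC : 0 ≤ (33 / 10 : ℝ) * (25 / 157) ^ (2 * T.nu + 1) := by positivity
  have hD : 0 ≤ 1 / ((T.N : ℝ) ^ (2 * T.nu) * (2 * T.nu)) := by positivity
  have h1 : ‖hurwitzEmRem T.N T.nu T.a s‖ ≤
      ((U : ℝ) / T.S) * ((33 / 10 : ℝ) * (25 / 157) ^ (2 * T.nu + 1)) *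
        (1 / ((T.N : ℝ) ^ (2 * T.nu) * (2 * T.nu))) :=
    hR.trans (mul_le_mul_of_nonneg_right (mul_le_mul_of_nonneg_right hP hC) hD)
  have hUnn : (0 : ℝ) ≤ U := by
    have := pochBoundH_spec hT hs (2 * T.nu + 1)
    exact le_trans (by positivity) this
  calc ‖hurwitzEmRem T.N T.nu T.a s‖ * T.S *
        (10 * 157 ^ (2 * T.nu + 1) * (T.N : ℝ) ^ (2 * T.nu) * (2 * T.nu))
      ≤ ((U : ℝ) / T.S) * ((33 / 10 : ℝ) * (25 / 157) ^ (2 * T.nu + 1)) *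
          (1 / ((T.N : ℝ) ^ (2 * T.nu) * (2 * T.nu))) * T.S *
          (10 * 157 ^ (2 * T.nu + 1) * (T.N : ℝ) ^ (2 * T.nu) * (2 * T.nu)) := by
        gcongr
    _ = (U : ℝ) * 33 * 25 ^ (2 * T.nu + 1) := by
        rw [div_pow]
        field_simp

/-- **Soundness of the certified evaluator of `ζ(s, p/q)`**: for valid tables, `s ∈ sB`, `s ≠ 1`,
`hurwitzBox T sB = some Z` implies `ζ(s, p/q) ∈ Z`. [cite: Edwards1974, §6.4] -/
private theorem mem_hurwitzBox (hT : T.Valid) (hs : MC.mem T.S s sB) (hs1 : s ≠ 1) {Z : MC}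
    (h : hurwitzBox T sB = some Z) :
    MC.mem T.S (HurwitzZeta.hurwitzZeta (T.a : UnitAddCircle) s) Z := by
  unfold hurwitzBox at h
  split_ifs at h with hlo
  split at h
  · simp at h
  · rename_i A hA
    split at h
    · simp at h
    · rename_i M hM
      simp only [Option.some.injEq] at h
      subst h
      have hσ : 0 < s.re := MI.pos_of_lo_pos hs.1 hlo
      obtain ⟨-, hApow⟩ := powTableH_spec hT hs (T.N + 1) le_rfl hA
      have hApow' : ∀ n : ℕ, n ≤ T.N →
          MC.mem T.S ((((n + T.a : ℝ)) : ℂ) ^ (-s)) (A.getD n default) :=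
        fun n hn ↦ hApow n (Nat.lt_succ_of_le hn)
      have hmain := mem_mainBoxH hT hs hApow' hM
      have hterms := mem_termsBoxH hT hs hApow'
      have hsum := MC.mem_add hmain hterms
      rw [hurwitzZeta_eq_eulerMaclaurin_of_re_pos hT.one_le_N hT.a_pos hT.a_le_one hσ hs1 T.nu]
      apply MC.mem_widen hsum
      rw [show hurwitzEmMainZero T.N T.a s + ∑ k ∈ Finset.Icc 1 T.nu, hurwitzEmTerm T.N T.a s k +
          hurwitzEmRem T.N T.nu T.a s -
        (hurwitzEmMainZero T.N T.a s + ∑ j ∈ Finset.Icc 1 T.nu, hurwitzEmTerm T.N T.a s j) =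
          hurwitzEmRem T.N T.nu T.a s by ring]
      exact norm_hurwitzEmRem_mul_le_remRadiusH hT hs hσ

/-! ## The public evaluator of `ζ(s, p/q)` -/

/-- **Certified evaluator of the Hurwitz zeta function `ζ(s, p/q)`** (`0 < p ≤ q`) on a box `B ∋ s`
at scale `S`: Euler–Maclaurin summation with truncation point `N ≥ 1`, `ν ≥ 1` Bernoulli
corrections and the rigorous remainder radius; `π`, `log q`, `log (n + p/q)` are computed with
`guard` extra bits (`Klog`, `Kpi` series terms) and rounded to scale `S`; `Kexp/kexp`, `KI/kI` are
the Taylor / argument-halving parameters of `exp`, `expI`. Returns `none` when a parameter is out of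
range, a constant fails to evaluate, or `lo (re B) ≤ 0`. [folklore] -/
def hurwitzEval (S N ν p q guard Klog Kpi Kexp kexp KI kI : ℕ) (B : MC) : Option MC :=
  match mkHTables S N ν p q guard Klog Kpi Kexp kexp KI kI with
  | some T => hurwitzBox T B
  | none => none

/-- **Soundness of the certified Hurwitz evaluator** — the Euler–Maclaurin formula
`ζ(s, a) = S + I + T + R` with a rigorous bound for the remainder `R`, valid on `s ≠ 1` past the
abscissa where `R` converges, made effective in fixed-point interval arithmetic: if `s ∈ B` at
scale `S`, `s ≠ 1`, and the evaluator returns `Z`, then `ζ(s, p/q) ∈ Z`.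
[cite: Johansson2014, §2 eq. (S + I + T + R) and Theorem 1] [cite: Edwards1974, §6.4] -/
theorem mem_hurwitzEval {S N ν p q guard Klog Kpi Kexp kexp KI kI : ℕ} {s : ℂ} {B Z : MC}
    (hs : MC.mem S s B) (hs1 : s ≠ 1)
    (h : hurwitzEval S N ν p q guard Klog Kpi Kexp kexp KI kI B = some Z) :
    MC.mem S (HurwitzZeta.hurwitzZeta (((p : ℝ) / q : ℝ) : UnitAddCircle) s) Z := by
  unfold hurwitzEval at h
  split at h
  · rename_i T hT
    have hV : T.Valid := mkHTables_valid hT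
    have hS : T.S = S := mkHTables_S hT
    have ha : T.a = (p : ℝ) / q := by rw [HTables.a, mkHTables_p hT, mkHTables_q hT]
    rw [← hS] at hs ⊢
    rw [← ha]
    exact mem_hurwitzBox hV hs hs1 h
  · simp at h

end Soundness

/-! ## The Dirichlet `L`-function of the primitive character mod `4` -/

section Chi4

/-- Every Dirichlet character mod `4` is quadratic (its values are `0, ±1`: the units of `ℤ/4`
are `±1`). [cite: MontgomeryVaughan2007, Theorem 9.13] -/
theorem isQuadratic_of_modulus_four (χ : DirichletCharacter ℂ 4) : χ.IsQuadratic := by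
  intro a
  fin_cases a
  · left
    exact χ.map_nonunit (by decide)
  · right; left
    exact χ.map_one
  · left
    exact χ.map_nonunit (by decide)
  · right
    have h9 : χ (3 : ZMod 4) * χ (3 : ZMod 4) = 1 := by
      rw [← map_mul, show (3 : ZMod 4) * 3 = 1 by decide, map_one]
    exact mul_self_eq_one_iff.1 h9

/-- **`L(s, χ₄)` through Hurwitz zeta functions**: for the primitive character `χ` mod `4`,
`L(s, χ) = 4^{-s} (ζ(s, ¼) − ζ(s, ¾))` for all `s` (Mathlib's `ZMod.LFunction` is by definition
`q^{-s} Σ_j χ(j) ζ(s, j/q)`; `χ(1) = 1`, `χ(3) = −1`, `χ(0) = χ(2) = 0`).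
[cite: MontgomeryVaughan2007, §10.1 (10.13)] -/
theorem LFunction_eq_hurwitz_of_isPrimitive_four {χ : DirichletCharacter ℂ 4} (hχ : χ.IsPrimitive)
    (s : ℂ) :
    χ.LFunction s = (4 : ℂ) ^ (-s) *
      (HurwitzZeta.hurwitzZeta ((1 / 4 : ℝ) : UnitAddCircle) s -
        HurwitzZeta.hurwitzZeta ((3 / 4 : ℝ) : UnitAddCircle) s) := by
  have hquad := isQuadratic_of_modulus_four χ
  have h3 : χ (3 : ZMod 4) = -1 := PrimitiveQuadratic.apply_three_of_isPrimitive_four hχ hquad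
  have h0 : χ (0 : ZMod 4) = 0 := χ.map_nonunit (by decide)
  have h2 : χ (2 : ZMod 4) = 0 := χ.map_nonunit (by decide)
  have h1 : χ (1 : ZMod 4) = 1 := χ.map_one
  have ha1 : ZMod.toAddCircle (1 : ZMod 4) = ((1 / 4 : ℝ) : UnitAddCircle) := by
    rw [ZMod.toAddCircle_apply, show (1 : ZMod 4).val = 1 by decide]
    norm_num
  have ha3 : ZMod.toAddCircle (3 : ZMod 4) = ((3 / 4 : ℝ) : UnitAddCircle) := by
    rw [ZMod.toAddCircle_apply, show (3 : ZMod 4).val = 3 by decide]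
    norm_num
  rw [DirichletCharacter.LFunction, ZMod.LFunction]
  have hsum4 : ∀ f : ZMod 4 → ℂ, ∑ j, f j = f 0 + f 1 + f 2 + f 3 := fun f ↦ Fin.sum_univ_four f
  have hsum : ∑ j : ZMod 4, χ j * HurwitzZeta.hurwitzZeta (ZMod.toAddCircle j) s =
      HurwitzZeta.hurwitzZeta ((1 / 4 : ℝ) : UnitAddCircle) s -
        HurwitzZeta.hurwitzZeta ((3 / 4 : ℝ) : UnitAddCircle) s := by
    rw [hsum4, h0, h1, h2, h3, ha1, ha3]
    ring
  rw [hsum]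
  push_cast
  ring

variable {T₁ T₃ : HTables} {s : ℂ} {sB : MC}

/-- **The certified evaluator of `L(s, χ₄)`**: `4^{-s} · (ζ(s, ¼) − ζ(s, ¾))` from two Hurwitz
tables (`p/q = 1/4` and `3/4`, same scale). [folklore] -/
private def lchi4Box (T₁ T₃ : HTables) (sB : MC) : Option MC :=
  match qpowBox T₁ sB, hurwitzBox T₁ sB, hurwitzBox T₃ sB with
  | some F, some H₁, some H₃ => some (MC.mul T₁.S F (H₁.sub H₃))
  | _, _, _ => none

/-- **Soundness of the certified evaluator of `L(s, χ₄)`**: for valid tables with `p/q = 1/4`,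
`3/4` at a common scale, `s ∈ sB`, `s ≠ 1` and `lchi4Box T₁ T₃ sB = some Z`, the value `L(s, χ)`
of the primitive character `χ` mod `4` lies in `Z`. [cite: MontgomeryVaughan2007, §10.1 (10.13)] -/
private theorem mem_lchi4Box (hT₁ : T₁.Valid) (hT₃ : T₃.Valid) (hp₁ : T₁.p = 1) (hq₁ : T₁.q = 4)
    (hp₃ : T₃.p = 3) (hq₃ : T₃.q = 4) (hS : T₃.S = T₁.S) (hs : MC.mem T₁.S s sB) (hs1 : s ≠ 1)
    {Z : MC} (h : lchi4Box T₁ T₃ sB = some Z) {χ : DirichletCharacter ℂ 4} (hχ : χ.IsPrimitive) :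
    MC.mem T₁.S (χ.LFunction s) Z := by
  unfold lchi4Box at h
  split at h
  · rename_i F H₁ H₃ hF hH₁ hH₃
    simp only [Option.some.injEq] at h
    subst h
    have ha₁ : T₁.a = 1 / 4 := by simp [HTables.a, hp₁, hq₁]
    have ha₃ : T₃.a = 3 / 4 := by simp [HTables.a, hp₃, hq₃]
    have hF' := mem_qpowBox hT₁ hs hF
    rw [hq₁] at hF'
    have hH₁' := mem_hurwitzBox hT₁ hs hs1 hH₁
    rw [ha₁] at hH₁'
    have hs₃ : MC.mem T₃.S s sB := by rw [hS]; exact hs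
    have hH₃' := mem_hurwitzBox hT₃ hs₃ hs1 hH₃
    rw [ha₃, hS] at hH₃'
    rw [LFunction_eq_hurwitz_of_isPrimitive_four hχ]
    have := MC.mem_mul hT₁.S_pos hF' (MC.mem_sub hH₁' hH₃')
    push_cast at this ⊢
    exact this
  · simp at h

/-- **Certified evaluator of `L(s, χ₄)`** on a box `B ∋ s` at scale `S`:
`4^{-s} · (ζ(s, ¼) − ζ(s, ¾))` from two Hurwitz evaluations with the same parameters (as in
`hurwitzEval`). Returns `none` on any failure. [folklore] -/
def lchi4Eval (S N ν guard Klog Kpi Kexp kexp KI kI : ℕ) (B : MC) : Option MC :=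
  match mkHTables S N ν 1 4 guard Klog Kpi Kexp kexp KI kI,
    mkHTables S N ν 3 4 guard Klog Kpi Kexp kexp KI kI with
  | some T₁, some T₃ => lchi4Box T₁ T₃ B
  | _, _ => none

/-- **Soundness of the certified evaluator of `L(s, χ₄)`**: for the primitive character `χ` mod `4`
(`L(s, χ) = 4^{-s} Σ_a χ(a) ζ(s, a/4) = 4^{-s}(ζ(s, ¼) − ζ(s, ¾))`), if `s ∈ B` at scale `S`,
`s ≠ 1`, and the evaluator returns `Z`, then `L(s, χ) ∈ Z`.
[cite: MontgomeryVaughan2007, §10.1 (10.13)] -/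
theorem mem_lchi4Eval {S N ν guard Klog Kpi Kexp kexp KI kI : ℕ} {s : ℂ} {B Z : MC}
    {χ : DirichletCharacter ℂ 4} (hχ : χ.IsPrimitive) (hs : MC.mem S s B) (hs1 : s ≠ 1)
    (h : lchi4Eval S N ν guard Klog Kpi Kexp kexp KI kI B = some Z) :
    MC.mem S (χ.LFunction s) Z := by
  unfold lchi4Eval at h
  split at h
  · rename_i T₁ T₃ hT₁ hT₃
    have hV₁ : T₁.Valid := mkHTables_valid hT₁
    have hV₃ : T₃.Valid := mkHTables_valid hT₃
    have hS₁ : T₁.S = S := mkHTables_S hT₁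
    have hS₃ : T₃.S = T₁.S := by rw [mkHTables_S hT₃, hS₁]
    rw [← hS₁] at hs ⊢
    exact mem_lchi4Box hV₁ hV₃ (mkHTables_p hT₁) (mkHTables_q hT₁) (mkHTables_p hT₃)
      (mkHTables_q hT₃) hS₃ hs hs1 h hχ
  · simp at h

end Chi4

end Literature.NumberTheory.LFunctions.HurwitzNumerics
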